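import Literature.RingTheory.DiscreteValuationRing.DeligneSerreLiftingProofs
import Mathlib.RingTheory.Valuation.ValuationRing
import Mathlib.RingTheory.PrincipalIdealDomain
import Mathlib.Algebra.GCDMonoid.IntegrallyClosed
import Mathlib.FieldTheory.IsAlgClosed.Basic
import Mathlib.RingTheory.Ideal.GoingUp
import HarnessLib

/-!
# The Deligne–Serre lifting lemma over a valuation ring with algebraically closed fraction field

Topic `Literature/RingTheory/Valuation`; namespace `Literature.RingTheory.Valuation`.  THEOREMS ONLY
(no definition, no named fact).

Deligne–Serre, *Formes modulaires de poids 1*, Ann. Sci. ÉNS (4) 7 (1974), Lemme 6.11 (p. 522) lifts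
a system of eigenvalues `(a_T)` of commuting endomorphisms of a finite free module `M` over a DISCRETE
valuation ring `𝒪`, occurring on a common eigenvector of `M/𝔪M`, to a system `(a'_T)` occurring on a
common eigenvector of `𝒪' ⊗ M` for a discrete valuation ring `𝒪' ⊇ 𝒪` finite over `𝒪`
(`a'_T ≡ a_T (mod 𝔪')`); the tree proves it
(`Literature.RingTheory.DiscreteValuationRing.DeligneSerre1974.lemma611_holds`).  In the applications
(op. cit. 6.10; Billerey–Menares 2016, proof of Thm. 2.2, "According to [DeSe74]"; 2018, §3.2) the
coefficient field is `ℂ ≅ ℚ̄_p` and the congruences are to be read in `ℚ̄_p` under a FIXED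
isomorphism `ι : ℚ̄_p ≃ ℂ`, i.e. modulo the maximal ideal of the (non-discrete, non-Noetherian)
valuation ring `𝒪_ι = ι(𝒪_{ℚ̄_p})` of `ℂ` itself; the extension `𝒪'` and the embedding `K' → ℂ` of
Lemme 6.11 then have to be re-aligned with `ι`.  This file proves the variant of Lemme 6.11 that
makes this unnecessary:

* `exists_lift_of_character_of_isAlgClosed` — let `𝒪` be a valuation ring whose fraction field `K`
  is ALGEBRAICALLY CLOSED, `M` a finite free `𝒪`-module, `H` a commutative `𝒪`-algebra acting
  faithfully on `M` (`ι : H →ₐ End_𝒪 M` injective) and `χ : H → k = 𝒪/𝔪` a character.  Then there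
  are a character `χ₀ : H → 𝒪` with `χ₀ ≡ χ (mod 𝔪)` and a non-zero `g ∈ K ⊗_𝒪 M` with
  `h g = χ₀(h) g` for all `h ∈ H` — the eigenvalues lift INTO `𝒪` ITSELF;
* `exists_eigenvalue_lift_of_isAlgClosed` — the same for a set `𝒯` of pairwise commuting
  endomorphisms and a non-zero common eigenvector `f ∈ k ⊗ M` with eigenvalues `a_T`: there are
  `a'_T ∈ 𝒪` with `a'_T ≡ a_T (mod 𝔪)` and `0 ≠ g ∈ K ⊗ M` with `T g = a'_T g` for all `T ∈ 𝒯`.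

Proof (Deligne–Serre's, p. 522, with the last step short-circuited by algebraic closedness).  Let
`𝔫 = ker χ` and `𝔭 ⊆ 𝔫` a minimal prime of `H`; `𝔭 ∩ 𝒪 = 0` since the elements of a minimal prime
are zero divisors while `H ↪ End M` is torsion-free.  So `D = H/𝔭` is a domain containing `𝒪`,
integral over `𝒪` (Cayley–Hamilton in `End M`), hence — `K` being algebraically closed — it embeds
into `K` over `𝒪` (`IsAlgClosed.lift`; injective because a prime of the integral domain extension `D`
lying over `0` is `0`), with image in the integral closure of `𝒪` in `K`, which is `𝒪` (valuation
rings are integrally closed): this is `χ₀ : H → D → 𝒪`, `ker χ₀ = 𝔭 ⊆ 𝔫`, so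
`χ(h) = χ(χ₀(h)) = χ₀(h) mod 𝔪`.  ("Il existe donc un anneau de valuation discrète `𝒪'` … tel que
`H/𝔭 ⊂ 𝒪'`": here `𝒪' = 𝒪`.)  The eigenvector: `K ⊗ H` is a finite-dimensional commutative
`K`-algebra (it embeds in `End_K(K ⊗ M)` by flatness of `K = Frac 𝒪`), acting faithfully on
`K ⊗ M`; the kernel of `K ⊗ χ₀` is a maximal ideal of this artinian ring, hence an associated prime
of `K ⊗ M` (the tree's `exists_eigenvector_of_character`, run over the field `K`).

## References

* P. Deligne, J.-P. Serre, *Formes modulaires de poids 1*, Ann. Sci. ÉNS (4) 7 (1974), 507–530,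
  Lemme 6.11 and its proof (p. 522). [DeligneSerreASENS1974]
* N. Billerey, R. Menares, *On the modularity of reducible mod `l` Galois representations*, Math.
  Res. Lett. 23 (2016), §2, proof of Thm. 2.2. [BillereyMenares2016]
-/

universe u

open scoped TensorProduct

open IsLocalRing Module Literature.RingTheory.DiscreteValuationRing.DeligneSerre1974

namespace Literature.RingTheory.Valuation

/-! ### Lifting a character into `𝒪` -/

section Lift

variable {𝒪 : Type u} [CommRing 𝒪] [IsDomain 𝒪] [ValuationRing 𝒪]
  {K : Type u} [Field K] [Algebra 𝒪 K] [IsFractionRing 𝒪 K] [IsAlgClosed K]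
  {M : Type u} [AddCommGroup M] [Module 𝒪 M] [Module.Free 𝒪 M] [Module.Finite 𝒪 M]
  {H : Type u} [CommRing H] [Algebra 𝒪 H] {ι : H →ₐ[𝒪] Module.End 𝒪 M}

omit [ValuationRing 𝒪] [Module.Finite 𝒪 M] in
/-- A commutative algebra `H` acting faithfully on a finite free module over a domain is
torsion-free: the scalars act on `H` through non-zero-divisors. [folklore] -/
theorem mem_nonZeroDivisors_algebraMap (hι : Function.Injective ι) {s : 𝒪} (hs : s ≠ 0) :
    algebraMap 𝒪 H s ∈ nonZeroDivisors H := by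
  refine mem_nonZeroDivisors_iff_right.mpr fun h hh ↦ hι ?_
  refine LinearMap.ext fun m ↦ ?_
  have := congrArg (fun g : H ↦ ι g m) hh
  simp only [map_mul, AlgHom.commutes, Module.End.mul_apply, Module.algebraMap_end_apply,
    map_zero, LinearMap.zero_apply, map_smul, smul_eq_zero_iff_right hs] at this
  simpa using this

/-- **Deligne–Serre's lifting lemma over a valuation ring with algebraically closed fraction field,
for a character.** Let `𝒪` be a valuation ring with algebraically closed fraction field `K`, `M` a
finite free `𝒪`-module, `H` a commutative `𝒪`-algebra acting faithfully on `M` and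
`χ : H → k = 𝒪/𝔪` an `𝒪`-algebra homomorphism. Then there are an `𝒪`-algebra homomorphism
`χ₀ : H → 𝒪` lifting `χ` (`χ₀(h) ≡ χ(h) (mod 𝔪)`) and a non-zero common eigenvector `g ∈ K ⊗ M` of
`H` with character `χ₀`. [cite: DeligneSerreASENS1974, Lemme 6.11 (proof)] -/
theorem exists_lift_of_character_of_isAlgClosed (hι : Function.Injective ι)
    (χ : H →ₐ[𝒪] ResidueField 𝒪) :
    ∃ (χ₀ : H →ₐ[𝒪] 𝒪) (g : K ⊗[𝒪] M), g ≠ 0 ∧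
      (∀ h : H, (ι h).baseChange K g = algebraMap 𝒪 K (χ₀ h) • g) ∧
      ∀ h : H, residue 𝒪 (χ₀ h) = χ h := by
  classical
  haveI hkprime : (RingHom.ker χ).IsPrime := RingHom.ker_isPrime χ
  -- a minimal prime `p ⊆ ker χ`; it meets `𝒪` trivially
  obtain ⟨p, hpmin, hple⟩ :=
    Ideal.exists_minimalPrimes_le (I := (⊥ : Ideal H)) (J := RingHom.ker χ) bot_le
  haveI hp : p.IsPrime := hpmin.1.1
  have hpO : ∀ s : 𝒪, algebraMap 𝒪 H s ∈ p → s = 0 := by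
    intro s hs
    by_contra hs0
    exact notMem_nonZeroDivisors_of_mem_mem_minimalPrimes hs hpmin
      (mem_nonZeroDivisors_algebraMap hι hs0)
  -- `D = H / p`, a domain, integral over `𝒪`, into which `𝒪` injects
  haveI : IsDomain (H ⧸ p) := Ideal.Quotient.isDomain p
  have hinj : Function.Injective (algebraMap 𝒪 (H ⧸ p)) := by
    intro s t hst
    rw [← sub_eq_zero]
    apply hpO
    rw [IsScalarTower.algebraMap_apply 𝒪 H (H ⧸ p), IsScalarTower.algebraMap_apply 𝒪 H (H ⧸ p),
      Ideal.Quotient.algebraMap_eq, Ideal.Quotient.eq] at hst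
    rwa [map_sub]
  haveI : FaithfulSMul 𝒪 (H ⧸ p) := (faithfulSMul_iff_algebraMap_injective 𝒪 (H ⧸ p)).mpr hinj
  haveI : Algebra.IsIntegral 𝒪 H := Algebra.IsIntegral.of_injective ι hι
  haveI hDint : Algebra.IsIntegral 𝒪 (H ⧸ p) := ⟨fun x ↦ by
    obtain ⟨y, rfl⟩ := Ideal.Quotient.mk_surjective x
    exact (Algebra.IsIntegral.isIntegral (R := 𝒪) y).map (Ideal.Quotient.mkₐ 𝒪 p)⟩
  haveI : FaithfulSMul 𝒪 K :=
    (faithfulSMul_iff_algebraMap_injective 𝒪 K).mpr (IsFractionRing.injective 𝒪 K)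
  -- the embedding `D ↪ K` over `𝒪` (`K` algebraically closed), with image in `𝒪`
  let j : (H ⧸ p) →ₐ[𝒪] K := IsAlgClosed.lift
  have hker : RingHom.ker j.toRingHom = ⊥ := by
    refine Ideal.eq_bot_of_comap_eq_bot (R := 𝒪) ?_
    refine le_bot_iff.mp fun s hs ↦ ?_
    rw [Ideal.mem_comap, RingHom.mem_ker, AlgHom.toRingHom_eq_coe, AlgHom.coe_toRingHom,
      AlgHom.commutes] at hs
    exact (IsFractionRing.injective 𝒪 K) (by rw [hs, map_zero])
  have hjinj : Function.Injective j := by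
    rw [injective_iff_map_eq_zero]
    intro x hx
    have hx' : x ∈ RingHom.ker j.toRingHom := hx
    rwa [hker, Ideal.mem_bot] at hx'
  have hjint : ∀ x : H ⧸ p, ∃ y : 𝒪, algebraMap 𝒪 K y = j x := fun x ↦
    IsIntegrallyClosed.isIntegral_iff.mp ((Algebra.IsIntegral.isIntegral (R := 𝒪) x).map j)
  choose y hy using hjint
  -- `χ₀ : H → 𝒪`
  have hy_mul : ∀ a b, y (a * b) = y a * y b := fun a b ↦ IsFractionRing.injective 𝒪 K (by
    rw [map_mul, hy, hy, hy, map_mul])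
  have hy_add : ∀ a b, y (a + b) = y a + y b := fun a b ↦ IsFractionRing.injective 𝒪 K (by
    rw [map_add, hy, hy, hy, map_add])
  have hy_alg : ∀ s : 𝒪, y (algebraMap 𝒪 (H ⧸ p) s) = s := fun s ↦ IsFractionRing.injective 𝒪 K
    (by rw [hy, AlgHom.commutes])
  let χ₀ : H →ₐ[𝒪] 𝒪 :=
    { toFun := fun h ↦ y (Ideal.Quotient.mk p h)
      map_one' := by
        have := hy_alg 1
        rwa [map_one] at this
      map_mul' := fun a b ↦ by rw [map_mul, hy_mul]
      map_zero' := by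
        have := hy_alg 0
        rwa [map_zero] at this
      map_add' := fun a b ↦ by rw [map_add, hy_add]
      commutes' := fun s ↦ by
        rw [← Ideal.Quotient.algebraMap_eq, ← IsScalarTower.algebraMap_apply]
        exact hy_alg s }
  have hχ₀ : ∀ h : H, algebraMap 𝒪 K (χ₀ h) = j (Ideal.Quotient.mk p h) := fun h ↦ hy _
  have hkerχ₀ : ∀ h : H, χ₀ h = 0 → h ∈ p := fun h hh ↦ by
    have : j (Ideal.Quotient.mk p h) = 0 := by rw [← hχ₀, hh, map_zero]
    exact Ideal.Quotient.eq_zero_iff_mem.mp (hjinj (by rw [this, map_zero]))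
  -- the congruence `χ₀ ≡ χ`
  have hcong : ∀ h : H, residue 𝒪 (χ₀ h) = χ h := fun h ↦ by
    have hmem : h - algebraMap 𝒪 H (χ₀ h) ∈ p := hkerχ₀ _ (by
      rw [map_sub, AlgHom.commutes, Algebra.algebraMap_self_apply, sub_self])
    have h1 : χ (h - algebraMap 𝒪 H (χ₀ h)) = 0 := hple hmem
    rw [map_sub, AlgHom.commutes, sub_eq_zero] at h1
    rw [h1, ResidueField.algebraMap_eq]
  -- the eigenvector, over the field `K`
  haveI : Module.Flat 𝒪 K := IsLocalization.flat K (nonZeroDivisors 𝒪)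
  have hΦ : Function.Injective (actL K ι) := actL_injective hι
  haveI : Module.Finite K (K ⊗[𝒪] H) :=
    Module.Finite.of_injective (actL K ι).toLinearMap hΦ
  let ψ : H →ₐ[𝒪] K := (Algebra.ofId 𝒪 K).comp χ₀
  -- run the associated-prime argument for the `K`-algebra `A = K ⊗ H` acting on `K ⊗ M`
  haveI : IsArtinianRing (K ⊗[𝒪] H) := IsArtinianRing.of_finite K (K ⊗[𝒪] H)
  letI : Module (K ⊗[𝒪] H) (K ⊗[𝒪] M) := Module.compHom (K ⊗[𝒪] M) (actL K ι).toRingHom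
  have hsmul : ∀ (a : K ⊗[𝒪] H) (v : K ⊗[𝒪] M), a • v = actL K ι a v := fun _ _ ↦ rfl
  haveI : IsScalarTower K (K ⊗[𝒪] H) (K ⊗[𝒪] M) := ⟨fun l a v ↦ by simp [hsmul]⟩
  haveI : Module.Finite (K ⊗[𝒪] H) (K ⊗[𝒪] M) :=
    Module.Finite.of_restrictScalars_finite K (K ⊗[𝒪] H) (K ⊗[𝒪] M)
  have hχsurj : Function.Surjective (charL ψ) := fun l ↦
    ⟨algebraMap K (K ⊗[𝒪] H) l, AlgHom.commutes _ l⟩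
  haveI hPmax : (RingHom.ker (charL ψ)).IsMaximal := RingHom.ker_isMaximal_of_surjective _ hχsurj
  have hann : Module.annihilator (K ⊗[𝒪] H) (K ⊗[𝒪] M) = ⊥ := by
    refine le_bot_iff.mp fun a ha ↦ ?_
    rw [Module.mem_annihilator] at ha
    exact hΦ ((LinearMap.ext fun v ↦ ha v).trans (map_zero (actL K ι)).symm)
  have hPmin : RingHom.ker (charL ψ) ∈
      (Module.annihilator (K ⊗[𝒪] H) (K ⊗[𝒪] M)).minimalPrimes := by
    rw [hann]
    exact IsArtinianRing.mem_minimalPrimes bot_le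
  have hPass : IsAssociatedPrime (RingHom.ker (charL ψ)) (K ⊗[𝒪] M) :=
    Module.associatedPrimes.minimalPrimes_annihilator_subset_associatedPrimes _ _ hPmin
  obtain ⟨v, hv⟩ := (isAssociatedPrime_iff.mp hPass).2
  refine ⟨χ₀, v, ?_, fun h ↦ ?_, hcong⟩
  · rintro rfl
    apply hPmax.ne_top
    rw [hv, Submodule.colon_singleton_zero]
  · have hmem : (1 : K) ⊗ₜ[𝒪] h - algebraMap K (K ⊗[𝒪] H) (ψ h) ∈ RingHom.ker (charL ψ) := by
      rw [RingHom.mem_ker, map_sub, charL_tmul, AlgHom.commutes, one_mul]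
      simp
    rw [hv, Submodule.mem_colon_singleton, Submodule.mem_bot, sub_smul, sub_eq_zero,
      hsmul, hsmul, actL_tmul, one_smul, AlgHom.commutes] at hmem
    have hψ : ψ h = algebraMap 𝒪 K (χ₀ h) := rfl
    rw [← hψ]
    simpa using hmem

end Lift

/-! ### The lifting lemma for commuting endomorphisms -/

section Eigen

variable {𝒪 : Type u} [CommRing 𝒪] [IsDomain 𝒪] [ValuationRing 𝒪]
  {K : Type u} [Field K] [Algebra 𝒪 K] [IsFractionRing 𝒪 K] [IsAlgClosed K]
  {M : Type u} [AddCommGroup M] [Module 𝒪 M] [Module.Free 𝒪 M] [Module.Finite 𝒪 M]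

open scoped IsMulCommutative in
/-- **Deligne–Serre's lifting lemma (Lemme 6.11) over a valuation ring with algebraically closed
fraction field.** Let `𝒪` be a valuation ring with algebraically closed fraction field `K`, maximal
ideal `𝔪` and residue field `k`; `M` a finite free `𝒪`-module; `𝒯` a set of pairwise commuting
endomorphisms of `M`; `f ∈ k ⊗ M` a non-zero common eigenvector of the `T ∈ 𝒯` with eigenvalues
`a_T ∈ k`. Then there are `a'_T ∈ 𝒪` with `a'_T ≡ a_T (mod 𝔪)` and a non-zero `g ∈ K ⊗ M` with
`T g = a'_T g` for all `T ∈ 𝒯` — the eigenvalues lift into `𝒪` itself (no extension of `𝒪` is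
needed). [cite: DeligneSerreASENS1974, Lemme 6.11] -/
theorem exists_eigenvalue_lift_of_isAlgClosed (𝒯 : Set (Module.End 𝒪 M))
    (hcomm : ∀ S ∈ 𝒯, ∀ T ∈ 𝒯, Commute S T) (a : Module.End 𝒪 M → ResidueField 𝒪)
    {f : ResidueField 𝒪 ⊗[𝒪] M} (hf : f ≠ 0)
    (heig : ∀ T ∈ 𝒯, T.baseChange (ResidueField 𝒪) f = a T • f) :
    ∃ (a' : Module.End 𝒪 M → 𝒪) (g : K ⊗[𝒪] M), g ≠ 0 ∧
      (∀ T ∈ 𝒯, T.baseChange K g = algebraMap 𝒪 K (a' T) • g) ∧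
      ∀ T ∈ 𝒯, residue 𝒪 (a' T) = a T := by
  classical
  haveI : IsMulCommutative (Algebra.adjoin 𝒪 𝒯) :=
    Algebra.isMulCommutative_adjoin 𝒪 fun S hS T hT ↦ (hcomm S hS T hT).eq
  obtain ⟨χ, -, hχa⟩ := exists_eigenCharacter 𝒯 a hf heig
  obtain ⟨χ₀, g, hg, heig', hcong⟩ :=
    exists_lift_of_character_of_isAlgClosed (K := K) (ι := (Algebra.adjoin 𝒪 𝒯).val)
      Subtype.val_injective χ
  refine ⟨fun T ↦ if hT : T ∈ Algebra.adjoin 𝒪 𝒯 then χ₀ ⟨T, hT⟩ else 0, g, hg,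
    fun T hT ↦ ?_, fun T hT ↦ ?_⟩
  · have hT' : T ∈ Algebra.adjoin 𝒪 𝒯 := Algebra.subset_adjoin hT
    dsimp only
    rw [dif_pos hT']
    exact heig' ⟨T, hT'⟩
  · have hT' : T ∈ Algebra.adjoin 𝒪 𝒯 := Algebra.subset_adjoin hT
    dsimp only
    rw [dif_pos hT', hcong ⟨T, hT'⟩]
    exact hχa T hT

end Eigen

end Literature.RingTheory.Valuation
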